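import Literature.NumberTheory.EllipticCurves.IsogenyRamification
import Literature.NumberTheory.GaloisRepresentations.AbsGaloisGroup
import Mathlib.FieldTheory.Perfect
import Mathlib.FieldTheory.Finite.Basic
import HarnessLib

/-!
# The Frobenius twist `E^{(q)}` and the `q`-power Frobenius isogeny `E → E^{(q)}`

Topic `NumberTheory/EllipticCurves` (trunk T-ELLARITH), notion `cm_endomorphisms_isogeny`.
For a Weierstrass curve `E = W` over a field `K` of exponential characteristic `p` and
`q = p ^ n`, Silverman, *AEC*, II.2.10–2.12 and III.4.6: the curve `E^{(q)}` obtained by raising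
the coefficients of `W` to the `q`-th power, and the `q`-power **Frobenius morphism**
`Frob_q : E → E^{(q)}, (x, y) ↦ (x^q, y^q)`, an isogeny defined over `K` which is a bijection on
`K̄`-points, with `Frob_q^* K̄(E^{(q)}) = K̄(E)^q` (Prop. II.2.11(a),(b): purely inseparable of
degree `q`). Over a finite field with `q` elements `E^{(q)} = E` and `Frob_q` is the Frobenius
endomorphism of `Literature.NumberTheory.EllipticCurves.FrobeniusEndomorphism`; the twist by an
arbitrary power of `p` is what the factorisation of inseparable isogenies (Cor. II.2.12) and the
dual isogeny in characteristic `p` (Thm. III.6.1) require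
(`Literature.NumberTheory.EllipticCurves.IsogenyFrobeniusFactorProofs`).

## Main definitions and results (all proved)

* `WeierstrassCurve.frobeniusTwist p W n = E^{(p^n)}` (`W.map (iterateFrobenius K p n)`);
  `frobeniusTwist_zero`, `frobeniusTwist_frobeniusTwist` (`(E^{(p^n)})^{(p^m)} = E^{(p^{n+m})}`),
  `frobeniusTwist_eq_self_of_card` (`E^{(#k ^ N)} = E` over a finite field `k`), and
  `E^{(q)}` is elliptic when `E` is.
* `WeierstrassCurve.mapPoint f h : V(F) →+ V'(L)` — the group homomorphism on points induced by a
  ring homomorphism of fields `f : F → L` with `V.map f = V'` (Mathlib's `Affine.Point.map` is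
  stated for algebra homomorphisms only; the Frobenius of `K̄` is not `K̄`-linear).
* `WeierstrassCurve.frobeniusTwistMap p W n : E(K̄) →+ E^{(p^n)}(K̄)`, `(x, y) ↦ (x^{p^n}, y^{p^n})`;
  injective, surjective (`K̄` is perfect), `Γ_K`-equivariant, algebraic.
* `WeierstrassCurve.frobeniusTwistIsogeny p W n : Isogeny W (W.frobeniusTwist p n)` — the
  `p^n`-power Frobenius as a term of the prelude structure `WeierstrassCurve.Isogeny`; its kernel
  is trivial (`ker_frobeniusTwistIsogeny`, `card_ker_frobeniusTwistIsogeny`).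
* `pullbackX/Y_frobeniusTwistIsogeny` (`Frob^* x' = x^{p^n}`, `Frob^* y' = y^{p^n}`),
  **`mem_pullbackField_frobeniusTwistIsogeny_iff`** (`Frob^* K̄(E^{(q)}) = K̄(E)^q`, *AEC*
  II.2.11(a)) and **`deg_frobeniusTwistIsogeny`** (`deg Frob_q = q`, II.2.11(b)), the degree being
  read off from the ramification at `O` (`ord_O(x^q) = -2q = e · ord_O(x')`, the tree's
  `Isogeny.ramIdx_mul_card_ker` of `IsogenyRamification`).

## References

* [SilvermanAEC2009] J. H. Silverman, *The Arithmetic of Elliptic Curves*, 2nd ed., GTM 106,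
  Springer 2009: II.2.10–2.12 (the Frobenius morphism, `K(C)^q`, factorisation), III.4.6
  (Frobenius endomorphism), proof of Thm. III.6.1 (the dual of Frobenius), V.§3.

## Design

`noncomputable section`, `open scoped Classical`, one universe `u`, dot-notation extensions in
`namespace WeierstrassCurve`. The exponential characteristic `p` is an explicit argument with
`[ExpChar K p]` (so `p = 1` in characteristic zero, where everything is the identity); the
instances `ExpChar (AlgebraicClosure K) p`, `ExpChar K̄(E) p` are derived locally.
-/

noncomputable section

open scoped Classical

universe u v

namespace WeierstrassCurve

/-! ## Points along a ring homomorphism of fields -/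

section MapPoint

variable {F : Type u} {L : Type v} [Field F] [Field L] (f : F →+* L)
  {V : WeierstrassCurve F} {V' : WeierstrassCurve L}

/-- **The map on points induced by a homomorphism of fields** `f : F → L` carrying the
Weierstrass equation `V` to `V'` (`V.map f = V'`): `O ↦ O`, `(x, y) ↦ (f x, f y)`. The image is
a nonsingular point of `V'` by Mathlib's `Affine.map_nonsingular`; the hypothesis `V.map f = V'`
enters only the proof component, so no transport of data along it is needed. Silverman, *AEC*,
II.2.10 (for `f` the Frobenius), VII.§2 / VIII.§1 (base change and Galois action on points).
[folklore] -/
def mapPoint (h : V.map f = V') : V.toAffine.Point →+ V'.toAffine.Point where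
  toFun P := match P with
    | 0 => 0
    | .some x y hxy => .some (f x) (f y) (by
        rw [← h]; exact (Affine.map_nonsingular (W := V) f.injective x y).mpr hxy)
  map_zero' := rfl
  map_add' := by
    subst h
    rintro (_ | ⟨x₁, y₁, h₁⟩) (_ | ⟨x₂, y₂, h₂⟩)
    any_goals rfl
    by_cases hxy : x₁ = x₂ ∧ y₁ = V.toAffine.negY x₂ y₂
    · rw [Affine.Point.add_of_Y_eq hxy.1 hxy.2,
        Affine.Point.add_of_Y_eq (congr_arg f hxy.1) (by rw [hxy.2, Affine.map_negY])]
    · have hxy' : ¬(f x₁ = f x₂ ∧ f y₁ = (V.map f).toAffine.negY (f x₂) (f y₂)) := fun h' ↦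
        hxy ⟨f.injective h'.1, f.injective ((Affine.map_negY (W' := V.toAffine) f x₂ y₂) ▸ h'.2)⟩
      simp only [Affine.Point.add_some hxy, Affine.Point.add_some hxy', Affine.map_slope,
        Affine.map_addX, Affine.map_addY]

variable (h : V.map f = V')

/-- `O ↦ O`. [folklore] -/
@[simp] theorem mapPoint_zero : mapPoint f h 0 = 0 := rfl

/-- `(x, y) ↦ (f x, f y)`. [folklore] -/
@[simp] theorem mapPoint_some {x y : F} (hxy : V.toAffine.Nonsingular x y) :
    mapPoint f h (.some x y hxy) = .some (f x) (f y)
      (by rw [← h]; exact (Affine.map_nonsingular (W := V) f.injective x y).mpr hxy) :=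
  rfl

/-- The map on points along a field homomorphism is injective. [folklore] -/
theorem mapPoint_injective : Function.Injective (mapPoint f h) := by
  rintro (_ | ⟨x₁, y₁, h₁⟩) (_ | ⟨x₂, y₂, h₂⟩) e
  · rfl
  · exact (Affine.Point.some_ne_zero _ e.symm).elim
  · exact (Affine.Point.some_ne_zero _ e).elim
  · rw [mapPoint_some, mapPoint_some] at e
    obtain ⟨ex, ey⟩ := Affine.Point.some.inj e
    cases f.injective ex
    cases f.injective ey
    rfl

/-- The map on points along a *surjective* field homomorphism is surjective. [folklore] -/
theorem mapPoint_surjective (hf : Function.Surjective f) : Function.Surjective (mapPoint f h) := by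
  rintro (_ | ⟨u, v, huv⟩)
  · exact ⟨0, rfl⟩
  · obtain ⟨x, rfl⟩ := hf u
    obtain ⟨y, rfl⟩ := hf v
    have hxy : V.toAffine.Nonsingular x y := by
      rw [← h] at huv
      exact (Affine.map_nonsingular (W := V) f.injective x y).mp huv
    exact ⟨.some x y hxy, rfl⟩

end MapPoint

/-! ## The Frobenius twist `E^{(p^n)}` -/

section Twist

variable {K : Type u} [Field K] (p : ℕ) [ExpChar K p] (W : WeierstrassCurve K)

/-- **The Frobenius twist `E^{(q)}`, `q = p^n`**, of a Weierstrass curve `E = W` over a field of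
exponential characteristic `p`: the curve with Weierstrass coefficients `a_i^q` (the image of `W`
under the `q`-power Frobenius endomorphism of `K`). Silverman, *AEC*, II.2.10 ("the curve
`C^{(q)}` defined by raising the coefficients to the `q`-th power") and III.4.6.
[cite: SilvermanAEC2009, II.2.10] -/
def frobeniusTwist (n : ℕ) : WeierstrassCurve K :=
  W.map (iterateFrobenius K p n)

/-- `a₁(E^{(q)}) = a₁^q`. [folklore] -/
@[simp] theorem frobeniusTwist_a₁ (n : ℕ) : (W.frobeniusTwist p n).a₁ = W.a₁ ^ p ^ n := rfl
/-- `a₂(E^{(q)}) = a₂^q`. [folklore] -/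
@[simp] theorem frobeniusTwist_a₂ (n : ℕ) : (W.frobeniusTwist p n).a₂ = W.a₂ ^ p ^ n := rfl
/-- `a₃(E^{(q)}) = a₃^q`. [folklore] -/
@[simp] theorem frobeniusTwist_a₃ (n : ℕ) : (W.frobeniusTwist p n).a₃ = W.a₃ ^ p ^ n := rfl
/-- `a₄(E^{(q)}) = a₄^q`. [folklore] -/
@[simp] theorem frobeniusTwist_a₄ (n : ℕ) : (W.frobeniusTwist p n).a₄ = W.a₄ ^ p ^ n := rfl
/-- `a₆(E^{(q)}) = a₆^q`. [folklore] -/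
@[simp] theorem frobeniusTwist_a₆ (n : ℕ) : (W.frobeniusTwist p n).a₆ = W.a₆ ^ p ^ n := rfl

/-- `E^{(p^0)} = E`. [folklore] -/
theorem frobeniusTwist_zero : W.frobeniusTwist p 0 = W := by
  rw [frobeniusTwist, iterateFrobenius_zero]
  exact W.map_id

/-- `(E^{(p^n)})^{(p^m)} = E^{(p^{n+m})}`. [folklore] -/
theorem frobeniusTwist_frobeniusTwist (n m : ℕ) :
    (W.frobeniusTwist p n).frobeniusTwist p m = W.frobeniusTwist p (n + m) := by
  rw [frobeniusTwist, frobeniusTwist, frobeniusTwist, map_map, add_comm, iterateFrobenius_add]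

/-- The discriminant of `E^{(q)}` is `Δ^q`. [folklore] -/
theorem frobeniusTwist_Δ (n : ℕ) : (W.frobeniusTwist p n).Δ = W.Δ ^ p ^ n := by
  rw [frobeniusTwist, map_Δ, iterateFrobenius_def]

/-- `E^{(q)}` is elliptic when `E` is. Silverman, *AEC*, II.2.10 / III.4.6. [folklore] -/
instance instIsEllipticFrobeniusTwist [W.IsElliptic] (n : ℕ) : (W.frobeniusTwist p n).IsElliptic :=
  inferInstanceAs (W.map (iterateFrobenius K p n)).IsElliptic

/-- **Over a finite field `k` with `#k = p^d` the twist `E^{(p^{dN})} = E^{(#k^N)}` is `E`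
itself** (`a^{#k} = a` in `k`): the `#k`-power Frobenius morphism is an *endomorphism* of `E`
(Silverman, *AEC*, V.§2, the Frobenius endomorphism). [folklore] -/
theorem frobeniusTwist_eq_self_of_card [Finite K] {d : ℕ} (hd : Nat.card K = p ^ d) (N : ℕ) :
    W.frobeniusTwist p (d * N) = W := by
  letI := Fintype.ofFinite K
  have hq : ∀ a : K, a ^ p ^ (d * N) = a := fun a ↦ by
    rw [pow_mul, ← hd, Nat.card_eq_fintype_card, FiniteField.pow_card_pow]
  rw [frobeniusTwist]
  ext <;> simp [iterateFrobenius_def, hq]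

end Twist

/-! ## The Frobenius on geometric points -/

section GeomFrobenius

variable {K : Type u} [Field K] (p : ℕ) [ExpChar K p] (W : WeierstrassCurve K)

/-- `K̄` has the exponential characteristic of `K`. [folklore] -/
theorem expChar_algebraicClosure : ExpChar (AlgebraicClosure K) p :=
  expChar_of_injective_algebraMap (algebraMap K (AlgebraicClosure K)).injective p

attribute [local instance] expChar_algebraicClosure

/-- **`E^{(q)} ⊗ K̄` is the image of `E ⊗ K̄` under the `q`-power Frobenius of `K̄`** (the
coefficients `a_i ∈ K` being mapped to `a_i^q` either way). [folklore] -/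
theorem map_baseChange_iterateFrobenius (n : ℕ) :
    (W.baseChange (AlgebraicClosure K)).map (iterateFrobenius (AlgebraicClosure K) p n) =
      (W.frobeniusTwist p n).baseChange (AlgebraicClosure K) := by
  rw [frobeniusTwist, baseChange, baseChange, map_map, map_map]
  congr 1
  ext a
  simp [iterateFrobenius_def]

/-- **The `q`-power Frobenius on geometric points**, `q = p^n`:
`E(K̄) → E^{(q)}(K̄)`, `O ↦ O`, `(x, y) ↦ (x^q, y^q)`, a group homomorphism (the chord–tangent
formulas have coefficients in `K` and commute with `a ↦ a^q`). Silverman, *AEC*, II.2.10,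
III.4.6. [cite: SilvermanAEC2009, II.2.10] -/
def frobeniusTwistMap (n : ℕ) : W.geomPoints →+ (W.frobeniusTwist p n).geomPoints :=
  mapPoint (iterateFrobenius (AlgebraicClosure K) p n) (W.map_baseChange_iterateFrobenius p n)

variable {W} in
/-- `Frob (x, y) = (x^q, y^q)`. Silverman, *AEC*, II.2.10. [folklore] -/
theorem frobeniusTwistMap_some (n : ℕ) {x y : AlgebraicClosure K}
    (hxy : (W.baseChange (AlgebraicClosure K)).toAffine.Nonsingular x y) :
    ∃ h', W.frobeniusTwistMap p n (.some x y hxy) = .some (x ^ p ^ n) (y ^ p ^ n) h' :=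
  ⟨_, rfl⟩

/-- `Frob O = O`. [folklore] -/
@[simp] theorem frobeniusTwistMap_zero (n : ℕ) : W.frobeniusTwistMap p n 0 = 0 := rfl

/-- The Frobenius is injective on `K̄`-points. Silverman, *AEC*, II.2.11 (purely inseparable).
[folklore] -/
theorem frobeniusTwistMap_injective (n : ℕ) : Function.Injective (W.frobeniusTwistMap p n) :=
  mapPoint_injective _ _

/-- The Frobenius is surjective on `K̄`-points (`K̄` is perfect). [folklore] -/
theorem frobeniusTwistMap_surjective (n : ℕ) : Function.Surjective (W.frobeniusTwistMap p n) :=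
  mapPoint_surjective _ _ (iterateFrobeniusEquiv (AlgebraicClosure K) p n).surjective

/-- The Frobenius is bijective on `K̄`-points. Silverman, *AEC*, II.2.11–2.12 (a purely
inseparable map of degree `q` is a bijection on points). [folklore] -/
theorem frobeniusTwistMap_bijective (n : ℕ) : Function.Bijective (W.frobeniusTwistMap p n) :=
  ⟨W.frobeniusTwistMap_injective p n, W.frobeniusTwistMap_surjective p n⟩

/-- `Frob P = O ↔ P = O`. [folklore] -/
theorem frobeniusTwistMap_eq_zero_iff (n : ℕ) (P : W.geomPoints) :
    W.frobeniusTwistMap p n P = 0 ↔ P = 0 := by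
  rw [← (W.frobeniusTwistMap p n).map_zero]
  exact (W.frobeniusTwistMap_injective p n).eq_iff

/-- The coordinates of `Frob P` are the `q`-th powers of those of `P`. [folklore] -/
theorem xy_frobeniusTwistMap (n : ℕ) (P : W.geomPoints) (i : Fin 2) :
    geomPoints.xy (W.frobeniusTwistMap p n P) i = geomPoints.xy P i ^ p ^ n := by
  by_cases hP : P = 0
  · subst hP
    rw [map_zero, geomPoints.xy_zero, geomPoints.xy_zero, Pi.zero_apply]
    exact (zero_pow (expChar_pow_pos (AlgebraicClosure K) p n).ne').symm
  · obtain ⟨x, y, hxy, rfl⟩ := geomPoints.exists_eq_some hP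
    obtain ⟨h', e⟩ := frobeniusTwistMap_some p n hxy
    rw [e, geomPoints.xy_some, geomPoints.xy_some]
    fin_cases i <;> rfl

/-- Galois automorphisms act on coordinates: `σ (x(R)) = x(σ R)`, `σ (y(R)) = y(σ R)` (with
`σ ∈ Γ_K` read as the `K`-automorphism of `K̄` it is, `Field.absoluteGaloisGroup.toAlgEquiv`).
[folklore] -/
theorem geomPoints.toAlgEquiv_apply_xy (σ : Field.absoluteGaloisGroup K) (R : W.geomPoints) (i : Fin 2) :
    Field.absoluteGaloisGroup.toAlgEquiv K σ (geomPoints.xy R i) = geomPoints.xy (σ • R) i := by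
  cases R with
  | zero =>
    change Field.absoluteGaloisGroup.toAlgEquiv K σ (geomPoints.xy (0 : W.geomPoints) i) =
      geomPoints.xy (σ • (0 : W.geomPoints)) i
    rw [smul_zero, geomPoints.xy_zero]; simp
  | some a b h =>
    change Field.absoluteGaloisGroup.toAlgEquiv K σ
        (geomPoints.xy (Affine.Point.some a b h : W.geomPoints) i) =
      geomPoints.xy (Affine.Point.map ((Field.absoluteGaloisGroup.toAlgEquiv K σ :
        AlgebraicClosure K ≃ₐ[K] AlgebraicClosure K) :
          AlgebraicClosure K →ₐ[K] AlgebraicClosure K) (Affine.Point.some a b h)) i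
    rw [Affine.Point.map_some, geomPoints.xy_some, geomPoints.xy_some]
    fin_cases i <;> rfl

/-- **The Frobenius commutes with `Γ_K`**: `Frob (σ P) = σ (Frob P)` (`σ (x^q) = (σ x)^q`).
Silverman, *AEC*, II.2.10–2.11 (Frobenius is defined over `K`). [folklore] -/
theorem frobeniusTwistMap_smul (n : ℕ) (σ : Field.absoluteGaloisGroup K) (P : W.geomPoints) :
    W.frobeniusTwistMap p n (σ • P) = σ • W.frobeniusTwistMap p n P := by
  by_cases hP : P = 0
  · subst hP
    rw [smul_zero, map_zero, smul_zero]
  · have hσP : σ • P ≠ 0 := fun h ↦ hP ((smul_eq_zero_iff_eq σ).mp h)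
    have h1 : W.frobeniusTwistMap p n (σ • P) ≠ 0 := fun h ↦
      hσP ((W.frobeniusTwistMap_eq_zero_iff p n _).mp h)
    have h2 : σ • W.frobeniusTwistMap p n P ≠ 0 := fun h ↦
      hP ((W.frobeniusTwistMap_eq_zero_iff p n _).mp ((smul_eq_zero_iff_eq σ).mp h))
    refine geomPoints.eq_of_xy_eq h1 h2 (funext fun i ↦ ?_)
    rw [xy_frobeniusTwistMap, ← geomPoints.toAlgEquiv_apply_xy, ← geomPoints.toAlgEquiv_apply_xy,
      xy_frobeniusTwistMap, map_pow]

/-- **The Frobenius is the rational map `(x^q, y^q)` at every affine point**: the set of points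
where it does not agree with `(X^q / 1, Y^q / 1)` is contained in `{O}`. [folklore] -/
theorem finite_setOf_not_agrees_frobeniusTwistMap (n : ℕ) :
    {P : W.geomPoints | ¬ AgreesWithRationalMapAt W (W.frobeniusTwist p n)
      (MvPolynomial.X 0 ^ p ^ n) 1 (MvPolynomial.X 1 ^ p ^ n) 1 (W.frobeniusTwistMap p n) P}.Finite := by
  refine (Set.finite_singleton (0 : W.geomPoints)).subset fun P hP ↦ ?_
  rw [Set.mem_singleton_iff]
  by_contra hP0
  apply hP
  rw [agreesWithRationalMapAt_iff]
  refine ⟨hP0, by simp, by simp, ?_⟩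
  obtain ⟨x, y, hxy, rfl⟩ := geomPoints.exists_eq_some hP0
  obtain ⟨h', e⟩ := frobeniusTwistMap_some p n hxy
  simp only [geomPoints.xy_some, MvPolynomial.eval_X, map_pow, map_one, div_one,
    Matrix.cons_val_zero, Matrix.cons_val_one]
  exact ⟨h', e⟩

/-- **The Frobenius is algebraic** (it is the rational map `(x^q, y^q)` off `O`). [folklore] -/
theorem isAlgebraicOn_frobeniusTwistMap (n : ℕ) :
    IsAlgebraicOn W (W.frobeniusTwist p n) (W.frobeniusTwistMap p n) :=
  ⟨_, _, _, _, W.finite_setOf_not_agrees_frobeniusTwistMap p n⟩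

/-- **The `q`-power Frobenius isogeny `Frob_q : E → E^{(q)}`, `q = p^n`**, as a term of the
prelude structure `WeierstrassCurve.Isogeny` (homomorphism on `K̄`-points, algebraic,
`Γ_K`-equivariant, finite — indeed trivial — kernel). Silverman, *AEC*, II.2.10–2.11, III.4.6.
[cite: SilvermanAEC2009, II.2.10–2.11] -/
def frobeniusTwistIsogeny [W.IsElliptic] (n : ℕ) : Isogeny W (W.frobeniusTwist p n) where
  toAddMonoidHom := W.frobeniusTwistMap p n
  isAlgebraic := W.isAlgebraicOn_frobeniusTwistMap p n
  equivariant := W.frobeniusTwistMap_smul p n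
  finite_ker := by
    refine (Set.finite_singleton (0 : W.geomPoints)).subset fun P hP ↦ ?_
    exact (W.frobeniusTwistMap_eq_zero_iff p n P).mp hP

variable [W.IsElliptic]

/-- The Frobenius isogeny acts on points as `frobeniusTwistMap`. [folklore] -/
@[simp] theorem frobeniusTwistIsogeny_apply (n : ℕ) (P : W.geomPoints) :
    W.frobeniusTwistIsogeny p n P = W.frobeniusTwistMap p n P := rfl

/-- `ker Frob_q = 0`. Silverman, *AEC*, II.2.11 / III.4.6. [folklore] -/
theorem ker_frobeniusTwistIsogeny (n : ℕ) :
    (W.frobeniusTwistIsogeny p n).toAddMonoidHom.ker = ⊥ :=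
  (AddMonoidHom.ker_eq_bot_iff _).mpr (W.frobeniusTwistMap_injective p n)

/-- `#ker Frob_q = 1`. [folklore] -/
theorem card_ker_frobeniusTwistIsogeny (n : ℕ) :
    Nat.card (W.frobeniusTwistIsogeny p n).toAddMonoidHom.ker = 1 := by
  rw [ker_frobeniusTwistIsogeny, AddSubgroup.card_bot]

/-- The Frobenius isogeny is surjective on `K̄`-points. [folklore] -/
theorem frobeniusTwistIsogeny_surjective (n : ℕ) :
    Function.Surjective (W.frobeniusTwistIsogeny p n) :=
  W.frobeniusTwistMap_surjective p n

/-- The explicit rational representation `(x^q / 1, y^q / 1)` of the Frobenius. [folklore] -/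
def frobeniusRationalRep (n : ℕ) : RationalRep W (W.frobeniusTwist p n) (W.frobeniusTwistIsogeny p n) where
  P₁ := MvPolynomial.X 0 ^ p ^ n
  Q₁ := 1
  P₂ := MvPolynomial.X 1 ^ p ^ n
  Q₂ := 1
  finite := W.finite_setOf_not_agrees_frobeniusTwistMap p n

/-- **`Frob_q^* x' = x^q`.** Silverman, *AEC*, II.2.11 (proof). [folklore] -/
theorem pullbackX_frobeniusTwistIsogeny (n : ℕ) :
    (W.frobeniusTwistIsogeny p n).pullbackX = W.genX ^ p ^ n := by
  rw [(W.frobeniusTwistIsogeny p n).pullbackX_eq (W.frobeniusRationalRep p n), RationalRep.pullbackX]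
  change W.evalGeneric (MvPolynomial.X 0 ^ p ^ n) / W.evalGeneric 1 = _
  rw [map_one, div_one, map_pow, evalGeneric_eq_aeval, MvPolynomial.aeval_X]
  rfl

/-- **`Frob_q^* y' = y^q`.** Silverman, *AEC*, II.2.11 (proof). [folklore] -/
theorem pullbackY_frobeniusTwistIsogeny (n : ℕ) :
    (W.frobeniusTwistIsogeny p n).pullbackY = W.genY ^ p ^ n := by
  rw [(W.frobeniusTwistIsogeny p n).pullbackY_eq (W.frobeniusRationalRep p n), RationalRep.pullbackY]
  change W.evalGeneric (MvPolynomial.X 1 ^ p ^ n) / W.evalGeneric 1 = _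
  rw [map_one, div_one, map_pow, evalGeneric_eq_aeval, MvPolynomial.aeval_X]
  rfl

/-- `Frob_q^* K̄(E^{(q)}) = K̄(x^q, y^q)`. [folklore] -/
theorem pullbackField_frobeniusTwistIsogeny (n : ℕ) :
    (W.frobeniusTwistIsogeny p n).pullbackField =
      IntermediateField.adjoin (AlgebraicClosure K) {W.genX ^ p ^ n, W.genY ^ p ^ n} := by
  rw [Isogeny.pullbackField, pullbackX_frobeniusTwistIsogeny, pullbackY_frobeniusTwistIsogeny]

end GeomFrobenius

/-! ## `Frob_q^* K̄(E^{(q)}) = K̄(E)^q` and `deg Frob_q = q` (Silverman, *AEC*, Prop. II.2.11) -/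

section Degree


variable {K : Type u} [Field K] (p : ℕ) [ExpChar K p] (W : WeierstrassCurve K)

attribute [local instance] expChar_algebraicClosure

/-- `K̄(E)` has the exponential characteristic of `K`. [folklore] -/
theorem expChar_geomFunctionField : ExpChar W.geomFunctionField p :=
  expChar_of_injective_algebraMap (algebraMap K W.geomFunctionField).injective p

attribute [local instance] expChar_geomFunctionField

/-- **`K̄(E)^q = K̄(x^q, y^q)`**: the image of the `q`-power Frobenius endomorphism of the field
`K̄(E)` is the subfield generated over `K̄` by `x^q, y^q` (`K̄` being perfect, `K̄^q = K̄`).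
Silverman, *AEC*, proof of Cor. II.2.12 ("`K(C)^q = K(x^q, y^q)`… since `K` is perfect").
[cite: SilvermanAEC2009, Cor. II.2.12 (proof)] -/
theorem map_top_iterateFrobenius (n : ℕ) :
    (⊤ : Subfield W.geomFunctionField).map (iterateFrobenius W.geomFunctionField p n) =
      (IntermediateField.adjoin (AlgebraicClosure K) {W.genX ^ p ^ n, W.genY ^ p ^ n}).toSubfield := by
  have htop : (⊤ : Subfield W.geomFunctionField) =
      (IntermediateField.adjoin (AlgebraicClosure K) {W.genX, W.genY}).toSubfield := by
    rw [adjoin_genX_genY_eq_top]; rfl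
  rw [htop, IntermediateField.adjoin_toSubfield, IntermediateField.adjoin_toSubfield,
    RingHom.map_field_closure]
  congr 1
  rw [Set.image_union, Set.image_pair]
  congr 1
  · ext z
    constructor
    · rintro ⟨_, ⟨c, rfl⟩, rfl⟩
      exact ⟨c ^ p ^ n, by rw [iterateFrobenius_def, map_pow]⟩
    · rintro ⟨c, rfl⟩
      refine ⟨algebraMap _ _ ((iterateFrobeniusEquiv (AlgebraicClosure K) p n).symm c), ⟨_, rfl⟩, ?_⟩
      rw [iterateFrobenius_def, ← map_pow]
      congr 1
      exact (iterateFrobeniusEquiv (AlgebraicClosure K) p n).apply_symm_apply c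

variable [W.IsElliptic]

/-- **`Frob_q^* K̄(E^{(q)}) = K̄(E)^q`** (Silverman, *AEC*, Prop. II.2.11(a)): a function on `E`
is a pull-back along the `q`-power Frobenius iff it is a `q`-th power in `K̄(E)`.
[cite: SilvermanAEC2009, Prop. II.2.11(a)] -/
theorem mem_pullbackField_frobeniusTwistIsogeny_iff (n : ℕ) (z : W.geomFunctionField) :
    z ∈ (W.frobeniusTwistIsogeny p n).pullbackField ↔ ∃ w : W.geomFunctionField, w ^ p ^ n = z := by
  rw [pullbackField_frobeniusTwistIsogeny, ← IntermediateField.mem_toSubfield,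
    ← map_top_iterateFrobenius, Subfield.mem_map]
  simp [iterateFrobenius_def]

/-- `q`-th powers are pull-backs along `Frob_q`. [folklore] -/
theorem pow_mem_pullbackField_frobeniusTwistIsogeny (n : ℕ) (w : W.geomFunctionField) :
    w ^ p ^ n ∈ (W.frobeniusTwistIsogeny p n).pullbackField :=
  (W.mem_pullbackField_frobeniusTwistIsogeny_iff p n _).mpr ⟨w, rfl⟩

/-- `ord_P (u ^ m) = m · ord_P u`. [folklore] -/
theorem ordAt_pow (P : W.geomPoints) {u : W.geomFunctionField} (hu : u ≠ 0) (m : ℕ) :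
    W.ordAt P (u ^ m) = m * W.ordAt P u := by
  induction m with
  | zero => simp [ordAt_algebraMap P 1 |> fun h ↦ by simpa using h]
  | succ m ih => rw [pow_succ, ordAt_mul P (pow_ne_zero m hu) hu, ih]; push_cast; ring

/-- **The Frobenius is totally ramified: `e_{Frob_q} = q`** (`ord_O(Frob_q^* x') = ord_O(x^q) =
-2q = e · ord_O(x')`). Silverman, *AEC*, II.2.11 (proof of (b)). [folklore] -/
theorem ramIdx_frobeniusTwistIsogeny (n : ℕ) : (W.frobeniusTwistIsogeny p n).ramIdx = p ^ n := by
  set φ := W.frobeniusTwistIsogeny p n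
  have hx0 : W.genX ≠ 0 := fun h0 ↦ transcendental_genX W (h0 ▸ isAlgebraic_zero)
  have h := φ.ordAt_pullbackHom_eq 0 (W.frobeniusTwist p n).genX
  rw [Isogeny.pullbackHom_genX, pullbackX_frobeniusTwistIsogeny, map_zero, ordAt_zero_genX,
    ordAt_pow W 0 hx0 (p ^ n), ordAt_zero_genX] at h
  have : ((p ^ n : ℕ) : ℤ) = (φ.ramIdx : ℤ) := by push_cast at h ⊢; linarith
  exact_mod_cast this.symm

/-- **`deg Frob_q = q`** (Silverman, *AEC*, Prop. II.2.11(b): the `q`-power Frobenius is purely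
inseparable of degree `q`), from `e · #ker = deg` (`Isogeny.ramIdx_mul_card_ker`) with `e = q`
and `ker = 0`. [cite: SilvermanAEC2009, Prop. II.2.11(b)] -/
theorem deg_frobeniusTwistIsogeny (n : ℕ) : (W.frobeniusTwistIsogeny p n).deg = p ^ n := by
  rw [← (W.frobeniusTwistIsogeny p n).ramIdx_mul_card_ker, card_ker_frobeniusTwistIsogeny, mul_one,
    ramIdx_frobeniusTwistIsogeny]

/-- **`[K̄(E) : K̄(E)^q] = q`** (the degree of the Frobenius as a field degree).
[cite: SilvermanAEC2009, Prop. II.2.11(b)] -/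
theorem finrank_pullbackField_frobeniusTwistIsogeny (n : ℕ) :
    Module.finrank (W.frobeniusTwistIsogeny p n).pullbackField W.geomFunctionField = p ^ n :=
  W.deg_frobeniusTwistIsogeny p n

end Degree

end WeierstrassCurve
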